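import Mathlib

/-!
# `FeketeSOS.FeketeBoundedFanin` (stmt-ValiantsHypothesis-3998), line `witt-pascal-ufa` — stub `stub_wittFold`

Witt pairing + cyclic folding.  Over an algebraically closed field `K` of odd characteristic `p`, a
quadratic expression `Q = Σ_{j,j'<d} T_{jj'} w_j w_{j'}` in `d` polynomials is congruent modulo `X^p − 1`
to a sum of `t ≤ ⌈d/2⌉` products `A_l · B_l` of polynomials of degree `< p`, each factor having at most
`Σ_j |supp w_j|` monomials.

Proof.  (1) Symmetrise: `2 Q = Σ (T + Tᵀ)_{jj'} w_j w_{j'}`.  (2) Diagonalise the symmetric matrix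
`S = T + Tᵀ` by congruence WITHOUT inverting a basis change: for an `S`-orthogonal basis `b_1, …, b_d` of
`K^d` (`LinearMap.BilinForm.exists_orthogonal_basis`) and `n_k = b_kᵀ S b_k` one has the identity of
bilinear forms `S(x, y) = Σ_k n_k⁻¹ S(b_k, x) S(b_k, y)` (check it on the basis; `0⁻¹ = 0` takes care of
isotropic basis vectors), hence `2 Q = Σ_k c_k u_k²` with `u_k = Σ_j S(b_k, e_j) w_j`.  (3) Absorb
`c_k / 2 = s_k²` (`K` algebraically closed): `Q = Σ_k v_k²`, `v_k = s_k u_k`.  (4) Witt-pair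
`v₀² + v₁² = (v₀ + i v₁)(v₀ − i v₁)` with `i² = −1`, keeping a lone square for odd `d`: `t = ⌈d/2⌉`
products of `K`-linear combinations of the `w_j`, whose supports lie in `⋃_j supp w_j`.  (5) Fold every
factor `L ↦ Σ_{e ∈ supp L} L_e X^{e mod p}`: degree `< p`, no more monomials, and `X^p − 1 ∣ X^e − X^{e mod p}`.
-/

namespace Summit.ValiantsHypothesis.ValiantsHypothesis.Theorems.FeketeBoundedFaninWPU

open Polynomial

-- `Summit.ValiantsHypothesis.ValiantsHypothesis.…` is the tree's mandated single-conjunct layout (Sub = Summit).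
set_option linter.dupNamespace false

/-! ### Diagonalisation of a symmetric bilinear form along an orthogonal basis -/

/-- For a bilinear form `B` with an orthogonal basis `b` (orthogonal in both orders) and
`n_k = B (b_k, b_k)`, one has `B (x, y) = Σ_k n_k⁻¹ · B (b_k, x) · B (b_k, y)`; the convention `0⁻¹ = 0`
makes isotropic basis vectors harmless. -/
theorem wf_bilin_expand {K V ι : Type*} [Field K] [AddCommGroup V] [Module K V] [Fintype ι]
    (B : LinearMap.BilinForm K V) (b : Module.Basis ι K V)
    (hb : ∀ i j, i ≠ j → B (b i) (b j) = 0) (x y : V) :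
    B x y = ∑ k, (B (b k) (b k))⁻¹ * (B (b k) x * B (b k) y) := by
  classical
  have key : B = ∑ k, (B (b k) (b k))⁻¹ • LinearMap.BilinForm.linMulLin (B (b k)) (B (b k)) := by
    refine LinearMap.BilinForm.ext_basis b (fun i j => ?_)
    simp only [LinearMap.sum_apply, LinearMap.smul_apply, LinearMap.BilinForm.linMulLin_apply,
      smul_eq_mul]
    by_cases hij : i = j
    · subst hij
      rw [Fintype.sum_eq_single i]
      · by_cases hn : B (b i) (b i) = 0
        · rw [hn, mul_zero, mul_zero]
        · rw [← mul_assoc, inv_mul_cancel₀ hn, one_mul]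
      · intro k hki
        rw [hb k i hki, zero_mul, mul_zero]
    · rw [hb i j hij]
      symm
      refine Finset.sum_eq_zero fun k _ => ?_
      by_cases hki : k = i
      · subst hki
        rw [hb k j hij, mul_zero, mul_zero]
      · rw [hb k i hki, zero_mul, mul_zero]
  have h := congrArg (fun F : LinearMap.BilinForm K V => F x y) key
  simpa only [LinearMap.sum_apply, LinearMap.smul_apply, LinearMap.BilinForm.linMulLin_apply,
    smul_eq_mul] using h

/-- Congruence-diagonalisation of a symmetric matrix without inverting the basis change: over a field
with `2` invertible, a symmetric `d × d` matrix is `S = Σ_{k<d} c_k P_k P_kᵀ` for scalars `c_k` and row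
vectors `P_k`. -/
theorem wf_matrix_diag {K : Type*} [Field K] [Invertible (2 : K)] {d : ℕ}
    (S : Matrix (Fin d) (Fin d) K) (hS : S.IsSymm) :
    ∃ (c : Fin d → K) (P : Fin d → Fin d → K), ∀ j j', S j j' = ∑ k, c k * (P k j * P k j') := by
  have hs : (Matrix.toBilin' S).IsSymm := Matrix.isSymm_toBilin'_iff_isSymm.2 hS
  obtain ⟨v, hv⟩ :=
    LinearMap.BilinForm.exists_orthogonal_basis (LinearMap.BilinForm.isSymm_iff.1 hs)
  let e : Fin (Module.finrank K (Fin d → K)) ≃ Fin d := finCongr (Module.finrank_fin_fun K)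
  have hb : ∀ i j, i ≠ j → Matrix.toBilin' S (v.reindex e i) (v.reindex e j) = 0 := by
    intro i j hij
    rw [Module.Basis.reindex_apply, Module.Basis.reindex_apply]
    exact LinearMap.isOrthoᵢ_def.1 hv _ _ fun h => hij (e.symm.injective h)
  refine ⟨fun k => (Matrix.toBilin' S (v.reindex e k) (v.reindex e k))⁻¹,
    fun k j => Matrix.toBilin' S (v.reindex e k) (Pi.single j 1), fun j j' => ?_⟩
  rw [← Matrix.toBilin'_single S j j']
  exact wf_bilin_expand (Matrix.toBilin' S) (v.reindex e) hb _ _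

/-! ### The quadratic expression: symmetrisation and expansion along the diagonalisation -/

/-- Symmetrisation: `2 · Σ_{j,j'} T_{jj'} w_j w_{j'} = Σ_{j,j'} (T + Tᵀ)_{jj'} w_j w_{j'}`. -/
theorem wf_symmetrise {K : Type*} [Field K] {d : ℕ} (T : Matrix (Fin d) (Fin d) K)
    (w : Fin d → K[X]) :
    (2 : K[X]) * (∑ j, ∑ j', C (T j j') * (w j * w j')) =
      ∑ j, ∑ j', C ((T + T.transpose) j j') * (w j * w j') := by
  have h : (∑ j, ∑ j', C (T j j') * (w j * w j')) = ∑ j, ∑ j', C (T j' j) * (w j * w j') := by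
    rw [Finset.sum_comm]
    exact Finset.sum_congr rfl fun j _ => Finset.sum_congr rfl fun j' _ => by ring
  calc (2 : K[X]) * (∑ j, ∑ j', C (T j j') * (w j * w j'))
      = (∑ j, ∑ j', C (T j j') * (w j * w j')) + ∑ j, ∑ j', C (T j' j) * (w j * w j') := by
        rw [two_mul, ← h]
    _ = ∑ j, ∑ j', C ((T + T.transpose) j j') * (w j * w j') := by
        rw [← Finset.sum_add_distrib]
        refine Finset.sum_congr rfl fun j _ => ?_
        rw [← Finset.sum_add_distrib]
        refine Finset.sum_congr rfl fun j' _ => ?_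
        rw [Matrix.add_apply, Matrix.transpose_apply, map_add]
        ring

/-- Expansion along a congruence-diagonalisation: if `S_{jj'} = Σ_k c_k P_{kj} P_{kj'}` and
`u_k = Σ_j P_{kj} w_j`, then `Σ_{j,j'} S_{jj'} w_j w_{j'} = Σ_k c_k u_k²`. -/
theorem wf_quad_expand {K : Type*} [Field K] {d m : ℕ} (S : Matrix (Fin d) (Fin d) K)
    (c : Fin m → K) (P : Fin m → Fin d → K) (hS : ∀ j j', S j j' = ∑ k, c k * (P k j * P k j'))
    (w : Fin d → K[X]) (u : Fin m → K[X]) (hu : ∀ k, u k = ∑ j, C (P k j) * w j) :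
    (∑ j, ∑ j', C (S j j') * (w j * w j')) = ∑ k, C (c k) * (u k * u k) := by
  calc (∑ j, ∑ j', C (S j j') * (w j * w j'))
      = ∑ j, ∑ j', ∑ k, C (c k) * (C (P k j) * w j) * (C (P k j') * w j') := by
        refine Finset.sum_congr rfl fun j _ => Finset.sum_congr rfl fun j' _ => ?_
        rw [hS, map_sum, Finset.sum_mul]
        refine Finset.sum_congr rfl fun k _ => ?_
        rw [map_mul, map_mul]
        ring
    _ = ∑ k, ∑ j, ∑ j', C (c k) * (C (P k j) * w j) * (C (P k j') * w j') :=
        (Finset.sum_congr rfl fun _ _ => Finset.sum_comm).trans Finset.sum_comm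
    _ = ∑ k, C (c k) * (u k * u k) := by
        refine Finset.sum_congr rfl fun k _ => ?_
        rw [hu, Finset.sum_mul_sum, Finset.mul_sum]
        refine Finset.sum_congr rfl fun j _ => ?_
        rw [Finset.mul_sum]
        refine Finset.sum_congr rfl fun j' _ => ?_
        ring

/-! ### Witt pairing of a sum of squares -/

/-- Witt pairing: with `i² = −1`, a sum of `m` squares of members of a `K`-submodule `N ≤ K[X]` is a sum
of `t ≤ ⌈m/2⌉` products of two members of `N` (`v₀² + v₁² = (v₀ + i v₁)(v₀ − i v₁)`, a lone square
`v² = v · v` when `m` is odd). -/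
theorem wf_pair_squares {K : Type*} [Field K] (i : K) (hi : i * i = -1) (N : Submodule K K[X]) :
    ∀ (m : ℕ) (v : Fin m → K[X]), (∀ k, v k ∈ N) →
      ∃ (t : ℕ) (A B : Fin t → K[X]), 2 * t ≤ m + 1 ∧ (∀ l, A l ∈ N ∧ B l ∈ N) ∧
        ∑ k, v k * v k = ∑ l, A l * B l := by
  intro m
  induction m using Nat.twoStepInduction with
  | zero => exact fun v hv => ⟨0, v, v, by omega, fun l => ⟨hv l, hv l⟩, rfl⟩
  | one => exact fun v hv => ⟨1, v, v, by omega, fun l => ⟨hv l, hv l⟩, rfl⟩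
  | more n ih _ =>
    intro v hv
    obtain ⟨t, A, B, ht, hAB, hsum⟩ := ih (fun k => v k.succ.succ) fun k => hv _
    have hiv : C i * v 1 ∈ N := by
      rw [C_mul']
      exact N.smul_mem i (hv 1)
    refine ⟨t + 1, Fin.cons (v 0 + C i * v 1) A, Fin.cons (v 0 - C i * v 1) B, by omega, ?_, ?_⟩
    · refine Fin.cases ?_ (fun l => ?_)
      · simp only [Fin.cons_zero]
        exact ⟨N.add_mem (hv 0) hiv, N.sub_mem (hv 0) hiv⟩
      · simp only [Fin.cons_succ]
        exact hAB l
    · rw [Fin.sum_univ_succ, Fin.sum_univ_succ, Fin.sum_univ_succ]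
      simp only [Fin.cons_zero, Fin.cons_succ, Fin.succ_zero_eq_one]
      rw [← hsum]
      have hC : C i * C i = -1 := by rw [← C_mul, hi, C_neg, C_1]
      linear_combination (v 1 * v 1) * hC

/-! ### Supports of linear combinations -/

/-- A `K`-linear combination of the `w_j` is supported on `⋃_j supp w_j`. -/
theorem wf_support_subset_of_mem_span {K : Type*} [Field K] {d : ℕ} (w : Fin d → K[X]) {f : K[X]}
    (hf : f ∈ Submodule.span K (Set.range w)) :
    f.support ⊆ Finset.univ.biUnion fun j => (w j).support := by
  classical
  induction hf using Submodule.span_induction with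
  | mem x hx =>
    obtain ⟨j, rfl⟩ := hx
    exact Finset.subset_biUnion_of_mem (fun j => (w j).support) (Finset.mem_univ j)
  | zero => simp
  | add x y _ _ hx hy => exact Polynomial.support_add.trans (Finset.union_subset hx hy)
  | smul a x _ hx => exact (Polynomial.support_smul a x).trans hx

/-- A `K`-linear combination of the `w_j` has at most `Σ_j |supp w_j|` monomials. -/
theorem wf_card_support_le {K : Type*} [Field K] {d : ℕ} (w : Fin d → K[X]) {f : K[X]}
    (hf : f ∈ Submodule.span K (Set.range w)) :
    f.support.card ≤ ∑ j, (w j).support.card := by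
  classical
  exact (Finset.card_le_card (wf_support_subset_of_mem_span w hf)).trans Finset.card_biUnion_le

/-! ### Cyclic folding modulo `X^p − 1` -/

/-- `X^p − 1 ∣ X^e − X^{e mod p}`. -/
theorem wf_X_pow_sub_X_pow_mod_dvd {R : Type*} [CommRing R] (p e : ℕ) :
    (X ^ p - 1 : R[X]) ∣ X ^ e - X ^ (e % p) := by
  have h : (X : R[X]) ^ e = X ^ (e % p) * (X ^ p) ^ (e / p) := by
    rw [← pow_mul, ← pow_add, Nat.mod_add_div]
  rw [h, ← mul_sub_one]
  exact Dvd.dvd.mul_left (sub_one_dvd_pow_sub_one _ _) _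

/-- Cyclic folding: every polynomial `L` is congruent modulo `X^p − 1` (`0 < p`) to
`Σ_{e ∈ supp L} L_e X^{e mod p}`, of degree `< p` and with no more monomials than `L`. -/
theorem wf_fold {K : Type*} [Field K] (p : ℕ) (hp : 0 < p) (L : K[X]) :
    ∃ L' : K[X], L'.natDegree < p ∧ L'.support.card ≤ L.support.card ∧
      (X ^ p - 1 : K[X]) ∣ L - L' := by
  classical
  refine ⟨∑ e ∈ L.support, C (L.coeff e) * X ^ (e % p), ?_, ?_, ?_⟩
  · have h : (∑ e ∈ L.support, C (L.coeff e) * X ^ (e % p)).natDegree ≤ p - 1 :=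
      Polynomial.natDegree_sum_le_of_forall_le L.support (fun e => C (L.coeff e) * X ^ (e % p))
        fun e _ => (natDegree_C_mul_X_pow_le _ _).trans (Nat.le_sub_one_of_lt (Nat.mod_lt e hp))
    omega
  · calc (∑ e ∈ L.support, C (L.coeff e) * X ^ (e % p)).support.card
        ≤ (L.support.image fun e => e % p).card := Finset.card_le_card ?_
      _ ≤ L.support.card := Finset.card_image_le
    intro n hn
    rw [mem_support_iff, finsetSum_coeff] at hn
    by_contra hni
    apply hn
    refine Finset.sum_eq_zero fun e he => ?_
    rw [coeff_C_mul_X_pow, if_neg]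
    rintro rfl
    exact hni (Finset.mem_image_of_mem (fun e => e % p) he)
  · have key : L - ∑ e ∈ L.support, C (L.coeff e) * X ^ (e % p) =
        ∑ e ∈ L.support, C (L.coeff e) * (X ^ e - X ^ (e % p)) := by
      calc L - ∑ e ∈ L.support, C (L.coeff e) * X ^ (e % p)
          = (∑ e ∈ L.support, C (L.coeff e) * X ^ e) -
              ∑ e ∈ L.support, C (L.coeff e) * X ^ (e % p) := by
            rw [← L.as_sum_support_C_mul_X_pow]
        _ = ∑ e ∈ L.support, C (L.coeff e) * (X ^ e - X ^ (e % p)) := by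
            rw [← Finset.sum_sub_distrib]
            exact Finset.sum_congr rfl fun e _ => by ring
    rw [key]
    exact Finset.dvd_sum fun e _ => Dvd.dvd.mul_left (wf_X_pow_sub_X_pow_mod_dvd p e) _

/-- Folding both factors of a product: `q ∣ a − a'` and `q ∣ b − b'` give `q ∣ a b − a' b'`. -/
theorem wf_dvd_mul_sub_mul {R : Type*} [CommRing R] {q a a' b b' : R} (ha : q ∣ a - a')
    (hb : q ∣ b - b') : q ∣ a * b - a' * b' := by
  have h : a * b - a' * b' = (a - a') * b + a' * (b - b') := by ring
  rw [h]
  exact dvd_add (Dvd.dvd.mul_right ha _) (Dvd.dvd.mul_left hb _)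

/-! ### The stub -/

/-- **Stub B — Witt pairing + cyclic folding.**  Over an algebraically closed field `K` of odd
characteristic `p`, a quadratic expression `Σ_{j,j'<d} T_{jj'} w_j w_{j'}` is congruent modulo `X^p − 1` to a
sum of `t ≤ ⌈d/2⌉` products `A_l · B_l` of polynomials of degree `< p`, each factor having at most
`Σ_j |supp w_j|` monomials. -/
theorem stub_wittFold :
    ∀ (K : Type) [Field K] [IsAlgClosed K] (p : ℕ) [Fact p.Prime] [CharP K p], p ≠ 2 →
      ∀ (d : ℕ) (w : Fin d → K[X]) (T : Matrix (Fin d) (Fin d) K),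
        ∃ (t : ℕ) (A B : Fin t → K[X]), 2 * t ≤ d + 1 ∧
          (∀ l, (A l).natDegree < p ∧ (B l).natDegree < p) ∧
          (∀ l, (A l).support.card ≤ ∑ j, (w j).support.card ∧
                (B l).support.card ≤ ∑ j, (w j).support.card) ∧
          (X ^ p - 1 : K[X]) ∣ (∑ j, ∑ j', C (T j j') * (w j * w j')) - ∑ l, A l * B l := by
  intro K _ _ p _ _ hp2 d w T
  classical
  have hprime : p.Prime := Fact.out
  have hp0 : 0 < p := hprime.pos
  -- `2 ≠ 0` in `K`
  have h2 : (2 : K) ≠ 0 := by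
    intro h
    apply hp2
    have h' : ((2 : ℕ) : K) = 0 := by rw [Nat.cast_ofNat]; exact h
    exact (Nat.prime_dvd_prime_iff_eq hprime Nat.prime_two).1 ((CharP.cast_eq_zero_iff K p 2).1 h')
  haveI : Invertible (2 : K) := invertibleOfNonzero h2
  -- (1)+(2) symmetrise and diagonalise `S = T + Tᵀ`
  obtain ⟨c, P, hSP⟩ := wf_matrix_diag (T + T.transpose) (Matrix.isSymm_add_transpose_self T)
  set N : Submodule K K[X] := Submodule.span K (Set.range w) with hN
  obtain ⟨u, hu⟩ : ∃ u : Fin d → K[X], ∀ k, u k = ∑ j, C (P k j) * w j := ⟨_, fun k => rfl⟩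
  have hu_mem : ∀ k, u k ∈ N := fun k => by
    rw [hu]
    refine N.sum_mem fun j _ => ?_
    rw [C_mul']
    exact N.smul_mem _ (Submodule.subset_span ⟨j, rfl⟩)
  -- (3) absorb `c_k / 2 = s_k²`
  have hsq : ∀ k, ∃ s : K, (2 : K)⁻¹ * c k = s * s := fun k => IsAlgClosed.exists_eq_mul_self _
  choose s hs using hsq
  obtain ⟨v, hv⟩ : ∃ v : Fin d → K[X], ∀ k, v k = C (s k) * u k := ⟨_, fun k => rfl⟩
  have hv_mem : ∀ k, v k ∈ N := fun k => by
    rw [hv, C_mul']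
    exact N.smul_mem _ (hu_mem k)
  have hQ : (∑ j, ∑ j', C (T j j') * (w j * w j')) = ∑ k, v k * v k := by
    have h2Q : (2 : K[X]) * (∑ j, ∑ j', C (T j j') * (w j * w j')) = ∑ k, C (c k) * (u k * u k) := by
      rw [wf_symmetrise T w, wf_quad_expand (T + T.transpose) c P hSP w u hu]
    have hC2 : C (2⁻¹ : K) * (2 : K[X]) = 1 := by
      rw [← map_ofNat C 2, ← C_mul, inv_mul_cancel₀ h2, C_1]
    calc (∑ j, ∑ j', C (T j j') * (w j * w j'))
        = C (2⁻¹ : K) * ((2 : K[X]) * (∑ j, ∑ j', C (T j j') * (w j * w j'))) := by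
          rw [← mul_assoc, hC2, one_mul]
      _ = C (2⁻¹ : K) * ∑ k, C (c k) * (u k * u k) := by rw [h2Q]
      _ = ∑ k, v k * v k := by
          rw [Finset.mul_sum]
          refine Finset.sum_congr rfl fun k _ => ?_
          rw [hv, ← mul_assoc, ← C_mul, hs k, C_mul]
          ring
  -- (4) Witt pairing
  obtain ⟨i, hi⟩ := IsAlgClosed.exists_eq_mul_self (-1 : K)
  obtain ⟨t, A, B, ht, hABmem, hsum⟩ := wf_pair_squares i hi.symm N d v hv_mem
  -- (5) fold every factor
  choose fo hfo_deg hfo_card hfo_dvd using fun L : K[X] => wf_fold p hp0 L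
  refine ⟨t, fun l => fo (A l), fun l => fo (B l), ht, fun l => ⟨hfo_deg _, hfo_deg _⟩,
    fun l => ⟨(hfo_card _).trans (wf_card_support_le w (hABmem l).1),
      (hfo_card _).trans (wf_card_support_le w (hABmem l).2)⟩, ?_⟩
  rw [hQ, hsum, ← Finset.sum_sub_distrib]
  exact Finset.dvd_sum fun l _ => wf_dvd_mul_sub_mul (hfo_dvd _) (hfo_dvd _)

end Summit.ValiantsHypothesis.ValiantsHypothesis.Theorems.FeketeBoundedFaninWPU
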